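import Literature.MathematicalPhysics.QuantumFieldTheory.BalabanImbrieJaffe1984to88.BIJ85AxialGaugeFixTorus

/-!
# `Balaban1983to89.B8Eq115HierAxialTorus` — T. Bałaban, *Spaces of regular gauge field configurations on a lattice and gauge fixing
conditions*, Commun. Math. Phys. **99** (1985) 75–102 [Balaban1985RegularSpaces] ("B8"), Sect. B p. 78: the HIERARCHICAL BLOCK AXIAL GAUGE
**(1.15)** with the restricted gauge group **(1.14)** *"determine uniquely an element in each orbit"* — PROVED for U(1) on the torus of
record (`Setup`), for the tower of block averages built with the [BalabanImbrieJaffe1985] (2.10) average `Q` of record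
(`BIJ85BlockAveragesTorus.qU`), in the single-domain reading (all of the torus at every level)

statement-level skeleton of published theorems with citation tags; proofs where landed; nothing here is a claim about the Yang–Mills mass gap

PDF held: `paper:balaban1985-cmp99-regular-spaces-gauge-fixing` (journal page = PDF page + 74; p. 78 = PDF 4, text layer
`~/.lit/texts/paper-balaban1985-cmp99-regular-spaces-gauge-fixing/p0004.txt`, read this session); [BalabanImbrieJaffe1985]
`paper:balaban1985-cmp97-bij-higgs-minimizers` p. 303 [PDF 5] ((2.7), (2.10)), p. 306 [PDF 8] ((3.4), the `𝒢₀` sentences).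

CITATION HEADER (lean-in-tree rule).  Part of the lit-balaban TYPED SKELETON (HOME `run/shared/lean/pub/lit-balaban/`), READER/TYPER seat r18
(cross-paper DEFINITIONS: axial/Landau gauge fixing), gen 7, unit `lit-balaban-r18`; cross-paper definition rows **X02** (multi-level block axial
gauge (1.15)) and **X03** (residual gauge freedom, (1.14)) of `HOME/lit-balaban-r18/SKELETON-r18.md`; lead rows B8.Eq1.14 / B8.Eq1.15 (owner r05,
`proved-existing` on the `ℤ^d` tower of [Balaban1985Averaging] averages by the β cell's `B8Eq115GaugeFixing.gaugeFix_global`/`gaugeFix_unique`).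
THIS FILE is the torus-of-record companion: the same printed sentence for the tower `u, Qu, Q²u, …` of the C1/C2 average (2.10), iterating
r18 gen 7's one-level theorems of `BIJ85AxialGaugeFixTorus` (existence `deltaAx_gaugeAct_holFix`, residual group `𝒢₀`
`blockConst_of_deltaAx_gaugeAct`) with the gauge covariance `Q(u^h) = (Qu)^{h∘corner}` (`BIJ85BlockAveragesTorus.qU_gaugeAct`).

THE PRINTED TEXT (p. 78, verbatim from the text layer).  *"Because (Ū^{uj})_b = (Ūʲ)ᵘ_b = u(b₋)(Ūʲ)_b u⁻¹(b₊) for b ⊂ T^{(j)}, hence the set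
𝔅_k(𝔅_k, V) is invariant with respect to gauge transformations u satisfying the conditions u(y) = 1 for y ∈ 𝔅_k. (1.14) They form a subgroup
of the group of all gauge transformations and we are interested in spaces of orbits of this subgroup. … An axial gauge is defined by the
equations for x_j ∈ Λ_j, j = 1, …, k, we put Ū^{j−1}(Γ_{x_j,x_{j−1}}) = 1 for x_{j−1} ∈ B(x_j), Ū^{j−2}(Γ_{x_{j−1},x_{j−2}}) = 1 for
x_{j−2} ∈ B(x_{j−1}), …, U(Γ_{x₁,x}) = 1 for x ∈ B(x₁). (1.15) It is easy to see that these equations together with (1.14) for gauge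
transformations determine uniquely an element in each orbit."*

READINGS (declared).  (i) SINGLE-DOMAIN TOWER: `Ω₀ = … = Ω_k =` the whole torus `T^{(j)}` of `Setup`, so `Λ_i = ∅` for `i < k` and
`Λ_k = 𝔅_k = T^{(j+k)}`; then (1.15) is the conjunction *`u` axial, `Qu` axial, …, `Q^{k−1}u` axial* (`HierAx k`), axial = the tree gauge `δ_{Ax}`
of [BalabanImbrieJaffe1985] (3.4) / [B5] (1.10) at each level (r18's `BIJ88RenormTransf311.DeltaAx`), and (1.14) *"u(y) = 1 for y ∈ 𝔅_k"*
reads: `u = 1` at the sites of `T^{(j+k)}` regarded as sites of `T^{(j)}` (the `k`-fold block corners, [BalabanImbrieJaffe1985] (2.4)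
*"y = Ln denotes a corner of a block"*) — `TopTrivial k`.  (ii) The averages `Ūʲ` of B8 are those of [Balaban1985Averaging]; here the tower
is built with the [BalabanImbrieJaffe1985] (2.10) average of record `qU` (same contours, logarithm of the closed loop (2.11)) — the object of
the C1/C2 renormalization transformations ((3.11), (4.1), (4.17) of [BalabanImbrieJaffe1988]); the proof uses only its gauge covariance (2.8).
(iii) `G = U(1)` (r18's `BIJ88Sect3Statements.U1`), abelian; everything is stated by structural recursion on the depth `k` with the level `j`
running, so that no arithmetic on lattice levels enters the types.

WHAT IS PROVED (0 `sorry`; three definitions with bodies, the rest theorems).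
* DEFINITIONS: `HierAx k j u` ((1.15) for the tower of depth `k` from level `j`), `BlockConstK k j h` (`h` factors through the `k`-fold block
  map `x ↦ x_k` of [BalabanImbrieJaffe1985] (5.1.2) — the residual group of (1.15)), `TopTrivial k j h` ((1.14)).
* §1 EXISTENCE: **`exists_gaugeAct_hierAx`** — every orbit meets (1.15) (`j + k ≤ m + K`).
* §2 THE RESIDUAL GROUP OF (1.15) IS `BlockConstK k`: `hierAx_gaugeAct_of_blockConstK`, `blockConstK_of_hierAx_gaugeAct`,
  **`preservesHierAx_iff_blockConstK`**, `blockConstK_of_two_fixings`.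
* §3 (1.14) KILLS THE RESIDUAL GROUP: `eq_one_of_blockConstK_of_topTrivial`; normalising a transformation into the restricted group
  `exists_blockConstK_mul_topTrivial`; the restricted group is a group (`topTrivial_one`, `topTrivial_mul`, `topTrivial_inv`).
* §4 **`existsUnique_hierAx_restricted`** — *"these equations together with (1.14) for gauge transformations determine uniquely an element in
  each orbit"*: for every `u` there is EXACTLY ONE configuration of the form `u^h` with `h` in the restricted group (1.14) satisfying (1.15).
HONEST SCOPE.  U(1) only; single-domain tower (no regions `Ω_j`, no `Λ_j`-dependent mixing of levels); the average is (2.10) of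
[BalabanImbrieJaffe1985], not the [Balaban1985Averaging] average of B8 (reading (ii)); standing range `j + k ≤ m + K` of `Setup`; nothing of
B1–B16's estimates; NOT summit progress; NOT continuum; NOT Clay.  Imports `BIJ85AxialGaugeFixTorus` only; no Summits import; sub-namespace
`…Balaban1983to89.B8Eq115HierAxialTorus`; modifies nothing.
-/

namespace Literature.MathematicalPhysics.QuantumFieldTheory.Balaban1983to89.B8Eq115HierAxialTorus

open Literature.MathematicalPhysics.QuantumFieldTheory.BalabanImbrieJaffe1984to88
open BIJ88RenormTransf311 (IsAxialBond axialBonds mem_axialBonds DeltaAx)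
open BIJ85BlockAveragesTorus (corner blockOf_corner qU qU_gaugeAct)
open BIJ85AxialGaugeFixTorus (holFix deltaAx_gaugeAct_holFix gaugeAct_gaugeAct gaugeAct_blockConst_of_isAxialBond
  blockConst_of_deltaAx_gaugeAct)
open BIJ88Sect3Statements (U1)
open GaugeField (gaugeAct)

noncomputable section

variable {P : Params}

/-! ## §0 The three predicates, by recursion on the depth -/

/-- **(1.15), single-domain reading**: the hierarchical block axial gauge of depth `k` for a configuration `u` on `T^{(j)}` — `u` is axial
(`δ_{Ax}` of [BalabanImbrieJaffe1985] (3.4)), its block average `Qu` (2.10) is axial on `T^{(j+1)}`, …, `Q^{k−1}u` is axial on `T^{(j+k−1)}`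
(*"U(Γ_{x₁,x}) = 1 for x ∈ B(x₁), Ū(Γ_{x₂,x₁}) = 1 for x₁ ∈ B(x₂), …"*). [cite: Balaban1985RegularSpaces, (1.15) p.78] -/
def HierAx : (k j : ℕ) → GaugeField P j U1 → Prop
  | 0, _, _ => True
  | k + 1, j, U => DeltaAx U ∧ HierAx k (j + 1) (qU U)

/-- **The residual group of (1.15)**: `h` on `T^{(j)}` is constant on the `k`-fold blocks `B^k(y)`, i.e. factors through the `k`-fold block
map `x ↦ x_k` ([BalabanImbrieJaffe1985] (5.1.2)); recursively: `h = g ∘ blockOf` with `g` constant on the `(k−1)`-fold blocks of `T^{(j+1)}`.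
[cite: Balaban1985RegularSpaces, (1.15) p.78] -/
def BlockConstK : (k j : ℕ) → GaugeTransf P j U1 → Prop
  | 0, _, _ => True
  | k + 1, j, h => ∃ g : GaugeTransf P (j + 1) U1, (h = fun x => g (blockOf x)) ∧ BlockConstK k (j + 1) g

/-- **(1.14), single-domain reading** *"u(y) = 1 for y ∈ 𝔅_k"*, `𝔅_k = T^{(j+k)}`: `h = 1` at the `k`-fold block corners (the sites of
`T^{(j+k)}` regarded as sites of `T^{(j)}`, [BalabanImbrieJaffe1985] (2.4)); recursively through `corner`. [cite: Balaban1985RegularSpaces, (1.14) p.78] -/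
def TopTrivial : (k j : ℕ) → GaugeTransf P j U1 → Prop
  | 0, _, h => ∀ x, h x = 1
  | k + 1, j, h => TopTrivial k (j + 1) (fun y => h (corner y))

/-- kernel: depth `0` imposes nothing. [cite: Balaban1985RegularSpaces, (1.15) p.78] -/
@[simp] theorem hierAx_zero (j : ℕ) (U : GaugeField P j U1) : HierAx 0 j U := trivial

/-- kernel: unfolding one level of (1.15). [cite: Balaban1985RegularSpaces, (1.15) p.78] -/
theorem hierAx_succ (k j : ℕ) (U : GaugeField P j U1) : HierAx (k + 1) j U ↔ DeltaAx U ∧ HierAx k (j + 1) (qU U) := Iff.rfl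

/-- kernel: depth `0` residual group is everything. [cite: Balaban1985RegularSpaces, (1.15) p.78] -/
@[simp] theorem blockConstK_zero (j : ℕ) (h : GaugeTransf P j U1) : BlockConstK 0 j h := trivial

/-- kernel: unfolding one level of the residual group. [cite: Balaban1985RegularSpaces, (1.15) p.78] -/
theorem blockConstK_succ (k j : ℕ) (h : GaugeTransf P j U1) :
    BlockConstK (k + 1) j h ↔ ∃ g : GaugeTransf P (j + 1) U1, (h = fun x => g (blockOf x)) ∧ BlockConstK k (j + 1) g := Iff.rfl

/-- kernel: unfolding (1.14) at depth `0` and one level. [cite: Balaban1985RegularSpaces, (1.14) p.78] -/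
theorem topTrivial_zero (j : ℕ) (h : GaugeTransf P j U1) : TopTrivial 0 j h ↔ ∀ x, h x = 1 := Iff.rfl

/-- kernel: unfolding (1.14) one level. [cite: Balaban1985RegularSpaces, (1.14) p.78] -/
theorem topTrivial_succ (k j : ℕ) (h : GaugeTransf P j U1) :
    TopTrivial (k + 1) j h ↔ TopTrivial k (j + 1) (fun y => h (corner y)) := Iff.rfl

/-! ## §1 Existence: every orbit meets the hierarchical axial gauge -/

/-- kernel: a block-constant transformation `g ∘ blockOf` preserves `δ_{Ax}` and acts on the block average as `g`:
`Q(u^{g∘blockOf}) = (Qu)^g` ((2.8) for (2.10), `qU_gaugeAct`, and `blockOf ∘ corner = id`). [cite: BalabanImbrieJaffe1985, (2.10) p.303] -/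
theorem qU_gaugeAct_blockConst {j : ℕ} (hj : j + 1 ≤ P.m + P.K) (g : GaugeTransf P (j + 1) U1) (U : GaugeField P j U1) :
    qU (gaugeAct (fun x => g (blockOf x)) U) = gaugeAct g (qU U) := by
  rw [qU_gaugeAct hj]
  simp only [blockOf_corner hj]

/-- kernel: `δ_{Ax}(u^{g∘blockOf})` for axial `u` (the tree bonds are intra-block). [cite: BalabanImbrieJaffe1985, (3.4) p.306] -/
theorem deltaAx_gaugeAct_blockConst {j : ℕ} (hj : j + 1 ≤ P.m + P.K) (g : GaugeTransf P (j + 1) U1) {U : GaugeField P j U1}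
    (hU : DeltaAx U) : DeltaAx (gaugeAct (fun x => g (blockOf x)) U) := fun b hb => by
  rw [gaugeAct_blockConst_of_isAxialBond hj g U (mem_axialBonds.1 hb)]
  exact hU b hb

/-- **EXISTENCE OF THE HIERARCHICAL AXIAL GAUGE (1.15) on the torus of record**: for every U(1) configuration `u` on `T^{(j)}` and every
depth `k` with `j + k ≤ m + K` there is a gauge transformation `h` with `u^h, Q(u^h), …, Q^{k−1}(u^h)` all axial.  Proof = the printed
recipe level by level: fix `u` by `h₀(x) = u(Γ_{yx})` (`deltaAx_gaugeAct_holFix`), fix the tower of `Q(u^{h₀})` by induction with some `g` on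
`T^{(j+1)}`, and lift `g` block-constantly — the lift preserves the level-`j` gauge and moves `Q(u^{h₀})` to `(Q(u^{h₀}))^g`.
[cite: Balaban1985RegularSpaces, (1.15) p.78] -/
theorem exists_gaugeAct_hierAx :
    ∀ (k j : ℕ), j + k ≤ P.m + P.K → ∀ U : GaugeField P j U1, ∃ h : GaugeTransf P j U1, HierAx k j (gaugeAct h U)
  | 0, _, _, _ => ⟨fun _ => 1, trivial⟩
  | k + 1, j, hk, U => by
    have hj : j + 1 ≤ P.m + P.K := by omega
    obtain ⟨g, hg⟩ := exists_gaugeAct_hierAx k (j + 1) (by omega) (qU (gaugeAct (holFix U) U))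
    refine ⟨fun x => g (blockOf x) * holFix U x, ?_⟩
    rw [← gaugeAct_gaugeAct, hierAx_succ]
    exact ⟨deltaAx_gaugeAct_blockConst hj g (deltaAx_gaugeAct_holFix hj U), by rwa [qU_gaugeAct_blockConst hj]⟩

/-! ## §2 The residual group of (1.15) is `BlockConstK k` -/

/-- **Block-constant transformations of depth `k` preserve (1.15)** (`j + k ≤ m + K`). [cite: Balaban1985RegularSpaces, (1.15) p.78] -/
theorem hierAx_gaugeAct_of_blockConstK :
    ∀ (k j : ℕ), j + k ≤ P.m + P.K → ∀ {h : GaugeTransf P j U1} {U : GaugeField P j U1},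
      BlockConstK k j h → HierAx k j U → HierAx k j (gaugeAct h U)
  | 0, _, _, _, _, _, _ => trivial
  | k + 1, j, hk, h, U, hh, hU => by
    have hj : j + 1 ≤ P.m + P.K := by omega
    obtain ⟨g, rfl, hg⟩ := hh
    rw [hierAx_succ] at hU ⊢
    refine ⟨deltaAx_gaugeAct_blockConst hj g hU.1, ?_⟩
    rw [qU_gaugeAct_blockConst hj]
    exact hierAx_gaugeAct_of_blockConstK k (j + 1) (by omega) hg hU.2

/-- **A transformation between two configurations in the gauge (1.15) is block-constant of depth `k`**: if `u` and `u^h` both satisfy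
(1.15) then `h ∈ BlockConstK k` — level by level from r18 gen 7's one-level `blockConst_of_deltaAx_gaugeAct` (`h = h∘corner∘blockOf`) and
the covariance `Q(u^h) = (Qu)^{h∘corner}` (`j + k ≤ m + K`). [cite: Balaban1985RegularSpaces, (1.15) p.78] -/
theorem blockConstK_of_hierAx_gaugeAct :
    ∀ (k j : ℕ), j + k ≤ P.m + P.K → ∀ {h : GaugeTransf P j U1} {U : GaugeField P j U1},
      HierAx k j U → HierAx k j (gaugeAct h U) → BlockConstK k j h
  | 0, _, _, _, _, _, _ => trivial
  | k + 1, j, hk, h, U, hU, hhU => by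
    have hj : j + 1 ≤ P.m + P.K := by omega
    rw [hierAx_succ] at hU hhU
    refine ⟨fun y => h (corner y), blockConst_of_deltaAx_gaugeAct hj hU.1 hhU.1, ?_⟩
    have h2 := hhU.2
    rw [qU_gaugeAct hj] at h2
    exact blockConstK_of_hierAx_gaugeAct k (j + 1) (by omega) hU.2 h2

/-- **THE STABILISER OF THE HIERARCHICAL AXIAL GAUGE IS `BlockConstK k`**: `h` maps every configuration satisfying (1.15) to one satisfying
(1.15) iff `h` is constant on the `k`-fold blocks (⇒: test on a configuration in the gauge, which exists by §1; `j + k ≤ m + K`).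
[cite: Balaban1985RegularSpaces, (1.15) p.78] -/
theorem preservesHierAx_iff_blockConstK {k j : ℕ} (hk : j + k ≤ P.m + P.K) (h : GaugeTransf P j U1) :
    (∀ U : GaugeField P j U1, HierAx k j U → HierAx k j (gaugeAct h U)) ↔ BlockConstK k j h := by
  constructor
  · intro hpres
    obtain ⟨h₁, hU₁⟩ := exists_gaugeAct_hierAx k j hk (1 : GaugeField P j U1)
    exact blockConstK_of_hierAx_gaugeAct k j hk hU₁ (hpres _ hU₁)
  · intro hh U hU
    exact hierAx_gaugeAct_of_blockConstK k j hk hh hU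

/-- **Uniqueness of the fixing up to the residual group**: two transformations putting the same `u` into the gauge (1.15) differ by a
block-constant transformation of depth `k`: `h₂ = c·h₁`, `c ∈ BlockConstK k` (`j + k ≤ m + K`). [cite: Balaban1985RegularSpaces, (1.15) p.78] -/
theorem blockConstK_of_two_fixings {k j : ℕ} (hk : j + k ≤ P.m + P.K) {U : GaugeField P j U1} {h₁ h₂ : GaugeTransf P j U1}
    (hU₁ : HierAx k j (gaugeAct h₁ U)) (hU₂ : HierAx k j (gaugeAct h₂ U)) : BlockConstK k j (fun x => h₂ x * (h₁ x)⁻¹) := by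
  refine blockConstK_of_hierAx_gaugeAct k j hk hU₁ ?_
  rw [gaugeAct_gaugeAct]
  have e : (fun x => h₂ x * (h₁ x)⁻¹ * h₁ x) = h₂ := funext fun x => by rw [mul_assoc, inv_mul_cancel, mul_one]
  rwa [e]

/-! ## §3 (1.14) removes the residual freedom -/

/-- **(1.14) ∩ residual group = {1}**: a transformation that is constant on the `k`-fold blocks and equal to `1` at the `k`-fold corners is
the identity (`j + k ≤ m + K`). [cite: Balaban1985RegularSpaces, (1.14) p.78] -/
theorem eq_one_of_blockConstK_of_topTrivial :
    ∀ (k j : ℕ), j + k ≤ P.m + P.K → ∀ {h : GaugeTransf P j U1}, BlockConstK k j h → TopTrivial k j h → ∀ x, h x = 1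
  | 0, _, _, _, _, ht => ht
  | k + 1, j, hk, h, hh, ht => by
    have hj : j + 1 ≤ P.m + P.K := by omega
    obtain ⟨g, rfl, hg⟩ := hh
    rw [topTrivial_succ] at ht
    simp only [blockOf_corner hj] at ht
    intro x
    exact eq_one_of_blockConstK_of_topTrivial k (j + 1) (by omega) hg ht (blockOf x)

/-- **Normalisation into the restricted group (1.14)**: every `h` can be multiplied by a block-constant `c` of depth `k` so that `c·h = 1` at
the `k`-fold corners (`c` = the block-constant extension of `h⁻¹` restricted to the corners, level by level).
[cite: Balaban1985RegularSpaces, (1.14) p.78] -/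
theorem exists_blockConstK_mul_topTrivial :
    ∀ (k j : ℕ), j + k ≤ P.m + P.K → ∀ h : GaugeTransf P j U1,
      ∃ c : GaugeTransf P j U1, BlockConstK k j c ∧ TopTrivial k j (fun x => c x * h x)
  | 0, _, _, h => ⟨fun x => (h x)⁻¹, trivial, fun x => inv_mul_cancel (h x)⟩
  | k + 1, j, hk, h => by
    have hj : j + 1 ≤ P.m + P.K := by omega
    obtain ⟨c₁, hc₁, ht₁⟩ := exists_blockConstK_mul_topTrivial k (j + 1) (by omega) (fun y => h (corner y))
    refine ⟨fun x => c₁ (blockOf x), ⟨c₁, rfl, hc₁⟩, ?_⟩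
    rw [topTrivial_succ]
    simp only [blockOf_corner hj]
    exact ht₁

/-- kernel: `1` lies in the restricted group (1.14). [cite: Balaban1985RegularSpaces, (1.14) p.78] -/
theorem topTrivial_one : ∀ k j : ℕ, TopTrivial k j (fun _ : Site P j => (1 : U1))
  | 0, _ => fun _ => rfl
  | k + 1, j => topTrivial_one k (j + 1)

/-- kernel: the restricted group (1.14) is closed under products (*"They form a subgroup"*). [cite: Balaban1985RegularSpaces, (1.14) p.78] -/
theorem topTrivial_mul : ∀ (k j : ℕ) {h₁ h₂ : GaugeTransf P j U1},
    TopTrivial k j h₁ → TopTrivial k j h₂ → TopTrivial k j (fun x => h₁ x * h₂ x)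
  | 0, _, f₁, f₂, h1, h2 => fun x => show f₁ x * f₂ x = 1 by rw [h1 x, h2 x, mul_one]
  | k + 1, j, _, _, h1, h2 => topTrivial_mul k (j + 1) h1 h2

/-- kernel: the restricted group (1.14) is closed under inverses (*"They form a subgroup"*). [cite: Balaban1985RegularSpaces, (1.14) p.78] -/
theorem topTrivial_inv : ∀ (k j : ℕ) {h : GaugeTransf P j U1}, TopTrivial k j h → TopTrivial k j (fun x => (h x)⁻¹)
  | 0, _, f, h1 => fun x => show (f x)⁻¹ = 1 by rw [h1 x, inv_one]
  | k + 1, j, _, h1 => topTrivial_inv k (j + 1) h1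

/-! ## §4 "determine uniquely an element in each orbit" -/

/-- **Existence inside the restricted group**: every orbit of the restricted group (1.14) meets the hierarchical axial gauge (1.15)
(`j + k ≤ m + K`). [cite: Balaban1985RegularSpaces, (1.15) p.78] -/
theorem exists_gaugeAct_hierAx_topTrivial {k j : ℕ} (hk : j + k ≤ P.m + P.K) (U : GaugeField P j U1) :
    ∃ h : GaugeTransf P j U1, TopTrivial k j h ∧ HierAx k j (gaugeAct h U) := by
  obtain ⟨h₀, hU₀⟩ := exists_gaugeAct_hierAx k j hk U
  obtain ⟨c, hc, ht⟩ := exists_blockConstK_mul_topTrivial k j hk h₀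
  refine ⟨fun x => c x * h₀ x, ht, ?_⟩
  rw [← gaugeAct_gaugeAct]
  exact hierAx_gaugeAct_of_blockConstK k j hk hc hU₀

/-- **Uniqueness inside the restricted group**: two transformations of the restricted group (1.14) putting `u` into the gauge (1.15) are
equal (`j + k ≤ m + K`). [cite: Balaban1985RegularSpaces, (1.15) p.78] -/
theorem gaugeTransf_unique_of_hierAx_topTrivial {k j : ℕ} (hk : j + k ≤ P.m + P.K) {U : GaugeField P j U1} {h₁ h₂ : GaugeTransf P j U1}
    (ht₁ : TopTrivial k j h₁) (hU₁ : HierAx k j (gaugeAct h₁ U)) (ht₂ : TopTrivial k j h₂) (hU₂ : HierAx k j (gaugeAct h₂ U)) :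
    h₁ = h₂ := by
  have hc := blockConstK_of_two_fixings hk hU₁ hU₂
  have ht : TopTrivial k j (fun x => h₂ x * (h₁ x)⁻¹) := topTrivial_mul k j ht₂ (topTrivial_inv k j ht₁)
  funext x
  have e := eq_one_of_blockConstK_of_topTrivial k j hk hc ht x
  rw [mul_inv_eq_one] at e
  exact e.symm

/-- **B8 p. 78: (1.15) and (1.14) "determine uniquely an element in each orbit"** — on the torus of record, U(1), single-domain tower of the
(2.10) averages: for every configuration `u` on `T^{(j)}` and depth `k` (`j + k ≤ m + K`) there is EXACTLY ONE configuration `u′` in the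
orbit of `u` under the restricted gauge group (1.14) which satisfies the hierarchical block axial gauge (1.15).
[cite: Balaban1985RegularSpaces, (1.15) p.78] -/
theorem existsUnique_hierAx_restricted {k j : ℕ} (hk : j + k ≤ P.m + P.K) (U : GaugeField P j U1) :
    ∃! U' : GaugeField P j U1, (∃ h : GaugeTransf P j U1, TopTrivial k j h ∧ U' = gaugeAct h U) ∧ HierAx k j U' := by
  obtain ⟨h, ht, hU⟩ := exists_gaugeAct_hierAx_topTrivial hk U
  refine ⟨gaugeAct h U, ⟨⟨h, ht, rfl⟩, hU⟩, ?_⟩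
  rintro U' ⟨⟨h', ht', rfl⟩, hU'⟩
  rw [gaugeTransf_unique_of_hierAx_topTrivial hk ht' hU' ht hU]

/-- The same with the transformation as the unknown: EXACTLY ONE `h` in the restricted group (1.14) puts `u` into the gauge (1.15).
[cite: Balaban1985RegularSpaces, (1.15) p.78] -/
theorem existsUnique_gaugeTransf_hierAx {k j : ℕ} (hk : j + k ≤ P.m + P.K) (U : GaugeField P j U1) :
    ∃! h : GaugeTransf P j U1, TopTrivial k j h ∧ HierAx k j (gaugeAct h U) := by
  obtain ⟨h, ht, hU⟩ := exists_gaugeAct_hierAx_topTrivial hk U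
  exact ⟨h, ⟨ht, hU⟩, fun h' hh' => gaugeTransf_unique_of_hierAx_topTrivial hk hh'.1 hh'.2 ht hU⟩

/-- The one-level case is r18 gen 7's `BIJ85AxialGaugeFixTorus`: `HierAx 1 j u ↔ δ_{Ax}(u)`. [cite: BalabanImbrieJaffe1985, (3.4) p.306] -/
theorem hierAx_one_iff {j : ℕ} (U : GaugeField P j U1) : HierAx 1 j U ↔ DeltaAx U := by
  rw [hierAx_succ]
  exact ⟨fun h => h.1, fun h => ⟨h, trivial⟩⟩

end

end Literature.MathematicalPhysics.QuantumFieldTheory.Balaban1983to89.B8Eq115HierAxialTorus
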